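import Literature.NumberTheory.Weil1964.LocalLerayIndexLines
import Literature.RepresentationTheory.HeisenbergGroup.SchrodingerSiegelParabolic
import HarnessLib

/-!
# The Leray cocycle of `SL₂(F) = Sp(F ⊕ F)` for the Lagrangian line `F(1, 0)`: `c(g₁, g₂) = γ_ψ(c₁ c₂ c₁₂)`

Topic `NumberTheory/Weil1964`; namespace `Literature.NumberTheory.Weil1964`. KERNEL mathematics only (theorems; no
named fact, no `axiom`, no `sorry`). The instance of `LocalLerayIndexLines.lerayCocycle_span_singleton` for the
tree's rank-one symplectic plane: `W = F × F` with Weil's form `A = alt (polar (LinearMap.mul F F))`,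
`A((x, y), (x', y')) = x y' - x' y`, whose isometry group `symplecticGroup (polar (LinearMap.mul F F))` is the
tree's `SL₂(F)` (`RankOneGeneration`, `SchrodingerCommutant`, `RankOneLocalSection`), and the Lagrangian line
`ℓ₀ = F(1, 0)`. For `g ∈ SL₂(F)` the invariant `x(g) = A((1,0), g(1,0))` is the SECOND COORDINATE of `g(1, 0)` —
the entry `c` of `g = (a b; c d)` — and [Rangarao1993, Cor. 4.3] reads:
**`c_{ℓ₀}(g₁, g₂) = γ_ψ(c₁ c₂ c₁₂)`**, `c₁₂ = c(g₁g₂) = c₁a₂ + d₁c₂`, when `c₁ c₂ c₁₂ ≠ 0`, and `= 1` otherwise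
("`c(σ₁, σ₂) = 1` if …, `γ_F(½ c₁c₂(c₁a₂ + d₁c₂) x²)` otherwise"; `γ_ψ(a) = weilIndex ψ μ a`, Rao's `½` being his
normalisation of quadratic forms).

## References

* [Rangarao1993] R. Ranga Rao, *On some explicit formulas in the theory of Weil representation*, Pacific J. Math.
  157 (1993), Cor. 4.3, p. 359.
-/

set_option autoImplicit false

noncomputable section

open MeasureTheory
open Literature.RepresentationTheory.HeisenbergGroup
open scoped Classical

namespace Literature.NumberTheory.Weil1964

section SL2

variable {F : Type*} [Field F] [ValuativeRel F] [TopologicalSpace F] [IsNonarchimedeanLocalField F]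
variable [MeasurableSpace F] [BorelSpace F] (μ : Measure F) [μ.IsAddHaarMeasure] {ψ : AddChar F Circle}
  [Invertible (2 : F)]

omit [ValuativeRel F] [TopologicalSpace F] [IsNonarchimedeanLocalField F] [MeasurableSpace F] [BorelSpace F]
  [Invertible (2 : F)] in
/-- Weil's form of the plane: `A((x, y), (x', y')) = x y' - x' y`. [cite: Weil1964, n° 5, p. 150] -/
theorem alt_polar_mul_apply (v w : F × F) :
    alt (polar (LinearMap.mul F F)) v w = v.1 * w.2 - w.1 * v.2 := by
  rw [alt_apply, polar_apply, polar_apply, LinearMap.mul_apply', LinearMap.mul_apply']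

omit [ValuativeRel F] [TopologicalSpace F] [IsNonarchimedeanLocalField F] [MeasurableSpace F] [BorelSpace F]
  [Invertible (2 : F)] in
/-- `A` is alternating. [cite: Weil1964, n° 5, p. 150] -/
theorem isAlt_alt_polar_mul : (alt (polar (LinearMap.mul F F))).IsAlt := fun v => by
  rw [alt_polar_mul_apply]; ring

omit [ValuativeRel F] [TopologicalSpace F] [IsNonarchimedeanLocalField F] [MeasurableSpace F] [BorelSpace F]
  [Invertible (2 : F)] in
/-- **`x(g) = A((1,0), g(1,0))` is the second coordinate of `g(1, 0)`** (the entry `c` of `g`).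
[cite: Rangarao1993, Cor. 4.3, p. 359] -/
theorem alt_polar_mul_basis_apply (g : (F × F) ≃ₗ[F] (F × F)) :
    alt (polar (LinearMap.mul F F)) ((1 : F), (0 : F)) (g ((1 : F), (0 : F))) = (g ((1 : F), (0 : F))).2 := by
  rw [alt_polar_mul_apply, one_mul, mul_zero, sub_zero]

/-- **[Rangarao1993, Cor. 4.3]: the Leray cocycle of `SL₂(F)` for the line `F(1,0)`** —
`c(g₁, g₂) = γ_ψ(c₁ c₂ c₁₂)` with `cᵢ = (gᵢ(1,0))₂`, `c₁₂ = ((g₁g₂)(1,0))₂`, when `c₁ c₂ c₁₂ ≠ 0`, and `1` otherwise.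
[cite: Rangarao1993, Cor. 4.3, p. 359] -/
theorem lerayCocycle_sl₂ (hψ : ψ.IsContinuousNontrivial) (g₁ : symplecticGroup (polar (LinearMap.mul F F)))
    (g₂ : (F × F) ≃ₗ[F] (F × F)) :
    lerayCocycle ψ μ (alt (polar (LinearMap.mul F F))) (F ∙ ((1 : F), (0 : F)))
        (g₁ : (F × F) ≃ₗ[F] (F × F)) g₂ =
      if ((g₁ : (F × F) ≃ₗ[F] (F × F)) (1, 0)).2 * (g₂ (1, 0)).2 *
          (((g₁ : (F × F) ≃ₗ[F] (F × F)) * g₂) (1, 0)).2 = 0 then 1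
      else weilIndex ψ μ (((g₁ : (F × F) ≃ₗ[F] (F × F)) (1, 0)).2 * (g₂ (1, 0)).2 *
          (((g₁ : (F × F) ≃ₗ[F] (F × F)) * g₂) (1, 0)).2) := by
  have hu : ((1 : F), (0 : F)) ≠ 0 := fun h => one_ne_zero (congrArg Prod.fst h)
  have hg₁ : ∀ v w, alt (polar (LinearMap.mul F F)) ((g₁ : (F × F) ≃ₗ[F] (F × F)) v)
      ((g₁ : (F × F) ≃ₗ[F] (F × F)) w) = alt (polar (LinearMap.mul F F)) v w :=
    (mem_symplecticGroup _ _).1 g₁.2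
  rw [lerayCocycle_span_singleton μ hψ isAlt_alt_polar_mul hu hg₁ g₂, alt_polar_mul_basis_apply,
    alt_polar_mul_basis_apply, alt_polar_mul_basis_apply]

/-- in particular **`c(g₁, g₂) = 1` as soon as one of `g₁`, `g₂`, `g₁g₂` is upper triangular** (`c = 0`, i.e. in
the Borel = Siegel parabolic of the line). [cite: Rangarao1993, Cor. 4.3, p. 359] -/
theorem lerayCocycle_sl₂_eq_one (hψ : ψ.IsContinuousNontrivial) (g₁ : symplecticGroup (polar (LinearMap.mul F F)))
    (g₂ : (F × F) ≃ₗ[F] (F × F))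
    (h : ((g₁ : (F × F) ≃ₗ[F] (F × F)) (1, 0)).2 = 0 ∨ (g₂ (1, 0)).2 = 0 ∨
      (((g₁ : (F × F) ≃ₗ[F] (F × F)) * g₂) (1, 0)).2 = 0) :
    lerayCocycle ψ μ (alt (polar (LinearMap.mul F F))) (F ∙ ((1 : F), (0 : F)))
        (g₁ : (F × F) ≃ₗ[F] (F × F)) g₂ = 1 := by
  rw [lerayCocycle_sl₂ μ hψ g₁ g₂, if_pos]
  rcases h with h | h | h
  · rw [h, zero_mul, zero_mul]
  · rw [h, mul_zero, zero_mul]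
  · rw [h, mul_zero]

/-- and **`c(g₁, g₂) = γ_ψ(c₁ c₂ c₁₂)` when `c₁ c₂ c₁₂ ≠ 0`** (all three off the Borel).
[cite: Rangarao1993, Cor. 4.3, p. 359] -/
theorem lerayCocycle_sl₂_of_ne_zero (hψ : ψ.IsContinuousNontrivial)
    (g₁ : symplecticGroup (polar (LinearMap.mul F F))) (g₂ : (F × F) ≃ₗ[F] (F × F))
    (h : ((g₁ : (F × F) ≃ₗ[F] (F × F)) (1, 0)).2 * (g₂ (1, 0)).2 *
      (((g₁ : (F × F) ≃ₗ[F] (F × F)) * g₂) (1, 0)).2 ≠ 0) :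
    lerayCocycle ψ μ (alt (polar (LinearMap.mul F F))) (F ∙ ((1 : F), (0 : F)))
        (g₁ : (F × F) ≃ₗ[F] (F × F)) g₂ =
      weilIndex ψ μ (((g₁ : (F × F) ≃ₗ[F] (F × F)) (1, 0)).2 * (g₂ (1, 0)).2 *
        (((g₁ : (F × F) ≃ₗ[F] (F × F)) * g₂) (1, 0)).2) := by
  rw [lerayCocycle_sl₂ μ hψ g₁ g₂, if_neg h]

end SL2

end Literature.NumberTheory.Weil1964
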